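import Literature.Geometry.Kaehler.KaehlerProofs
import Literature.Geometry.Kaehler.ManifoldFormsChart
import Mathlib.Geometry.Manifold.MFDeriv.Atlas

/-!
# The coordinate expression of a Hermitian metric in a holomorphic chart, and its Kähler jet

For a complex manifold `M` (charts in the finite-dimensional complex normed space `E`,
holomorphic transition maps) with a smooth Riemannian metric on the real tangent bundle, written as
a family `G : M → E →L[ℝ] E →L[ℝ] ℝ` of bilinear forms on the model space with
`G x v w = ⟪v, w⟫ₓ`, and a point `x₀`, we study the **coordinate expression of the metric in the
chart `e = extChartAt 𝓘(ℝ, E) x₀`**: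

  `Ĝ y = G (e⁻¹ y) (S_y ·, S_y ·)`,  `S_y = tangentCoordChange 𝓘(ℝ, E) x₀ (e⁻¹ y) (e⁻¹ y)`

(`S_y` is the derivative of `e⁻¹` at `y`, `mfderivWithin_extChartAt_symm_eq_tangentCoordChange`),
as a function `E → (E →L[ℝ] E →L[ℝ] ℝ)` on the chart target:

* `chartDeriv_symm_apply_c`: `S_c = 1` at the centre `c = e x₀`, so `Ĝ c = G x₀`
  (`chartMetric_apply_c`);
* `chartDeriv_symm_I_smul`: `S_y (i v) = i S_y v` (holomorphic atlas,
  `tangentCoordChange_eq_restrictScalars`);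
* `chartMetric_symm`, `chartMetric_hermitian`: `Ĝ y` is symmetric, and Hermitian
  (`Ĝ y (iv) (iw) = Ĝ y v w`) when the metric is;
* `contDiffAt_chartMetric`: `Ĝ` is `C^∞` at every point of the chart target (it is the
  coordinate expression of the smooth metric section in the trivialization at `x₀`,
  `trivializationAt_bilinForm_apply₂`, `Trivialization.contMDiffAt_iff`);
* `chartMetric_pos`: `Ĝ c = G x₀` is positive definite;
* **the Kähler relation for the first jet** (`chartMetric_kaehler_jet`): if the Kähler form
  `ω(v, w) = ⟪Jv, w⟫` is closed, then `D = DĜ(c)` satisfies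
  `D u (iv) w - D v (iu) w + D w (iu) v = 0` — the chart expression of `dω(x₀) = 0`
  (`mextDeriv_eq_extDerivWithin`, `extDeriv_apply`), the hypothesis `hK` of `koszul_J'`
  (`OsculatingUnitaryFrameProofs.lean`; Voisin (2002), Prop. 3.14 / Thm. 3.13).

All objects are written out (local notations); no definitions.

## References

* C. Voisin, *Hodge Theory and Complex Algebraic Geometry I* (2002), §2.2.1, §3.1.2, §3.1.3,
  Prop. 3.14. [Voisin2002]
-/

noncomputable section

open scoped Manifold ContDiff Topology RealInnerProductSpace
open Set Function Bundle Module Filter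

namespace Literature.Geometry.Kaehler

set_option quotPrecheck false

section ChartMetric

variable {E : Type*} [NormedAddCommGroup E] [NormedSpace ℂ E]
  {M : Type*} [TopologicalSpace M] [ChartedSpace E M] [IsManifold 𝓘(ℝ, E) ∞ M]

/-- The derivative of the inverse chart `e⁻¹` at a point `y` of the target of the chart
`e = extChartAt 𝓘(ℝ, E) x₀`, as a map of the model space. -/
local notation "Sc[" x₀ ", " y "]" => tangentCoordChange 𝓘(ℝ, E) x₀
  ((extChartAt 𝓘(ℝ, E) x₀).symm y) ((extChartAt 𝓘(ℝ, E) x₀).symm y)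

/-- The coordinate expression `Ĝ y = G (e⁻¹ y) (S_y ·, S_y ·)` of the metric family `G` in the
chart at `x₀`. -/
local notation "Ĝ[" G ", " x₀ ", " y "]" => ContinuousLinearMap.bilinearComp
  (G ((extChartAt 𝓘(ℝ, E) x₀).symm y)) (Sc[x₀, y]) (Sc[x₀, y])

/-- **`S_c = 1`**: at the centre of the chart the derivative of the inverse chart is the
identity (`tangentCoordChange_self`). [folklore] -/
theorem chartDeriv_symm_apply_c (x₀ : M) :
    Sc[x₀, extChartAt 𝓘(ℝ, E) x₀ x₀] = (1 : E →L[ℝ] E) := by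
  ext v
  rw [extChartAt_to_inv, one_apply_eq_self]
  exact tangentCoordChange_self (mem_extChartAt_source x₀)

/-- `Ĝ c = G x₀`. [folklore] -/
theorem chartMetric_apply_c (G : M → E →L[ℝ] E →L[ℝ] ℝ) (x₀ : M) :
    Ĝ[G, x₀, extChartAt 𝓘(ℝ, E) x₀ x₀] = G x₀ := by
  ext v w
  rw [ContinuousLinearMap.bilinearComp_apply, chartDeriv_symm_apply_c, one_apply_eq_self,
    one_apply_eq_self, extChartAt_to_inv]

/-- `Ĝ y` is symmetric when `G` is. [folklore] -/
theorem chartMetric_symm (G : M → E →L[ℝ] E →L[ℝ] ℝ) (hGs : ∀ x v w, G x v w = G x w v) (x₀ : M)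
    (y : E) (v w : E) : Ĝ[G, x₀, y] v w = Ĝ[G, x₀, y] w v := by
  rw [ContinuousLinearMap.bilinearComp_apply, ContinuousLinearMap.bilinearComp_apply, hGs]

variable [IsManifold 𝓘(ℂ, E) ω M]

/-- **The derivative of the inverse chart is `ℂ`-linear** (holomorphic atlas): `S_y (i v) = i S_y v`
for `y` in the chart target. [cite: Voisin2002, §2.2.1] -/
theorem chartDeriv_symm_I_smul (x₀ : M) {y : E} (hy : y ∈ (extChartAt 𝓘(ℝ, E) x₀).target)
    (v : E) : Sc[x₀, y] (Complex.I • v) = Complex.I • Sc[x₀, y] v := by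
  set z : M := (extChartAt 𝓘(ℝ, E) x₀).symm y with hz
  have hz' : z ∈ (extChartAt 𝓘(ℂ, E) x₀).source ∩ (extChartAt 𝓘(ℂ, E) z).source := by
    refine ⟨?_, mem_extChartAt_source z⟩
    rw [extChartAt_source]
    have := (extChartAt 𝓘(ℝ, E) x₀).map_target hy
    rwa [extChartAt_source] at this
  rw [tangentCoordChange_eq_restrictScalars hz', ContinuousLinearMap.coe_restrictScalars',
    ContinuousLinearMap.map_smul]

/-- `Ĝ y` is Hermitian (`Ĝ y (iv) (iw) = Ĝ y v w`) for `y` in the chart target when the metric is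
Hermitian. [cite: Voisin2002, §3.1.2] -/
theorem chartMetric_hermitian (G : M → E →L[ℝ] E →L[ℝ] ℝ)
    (hH : ∀ x v w, G x (Complex.I • v) (Complex.I • w) = G x v w) (x₀ : M) {y : E}
    (hy : y ∈ (extChartAt 𝓘(ℝ, E) x₀).target) (v w : E) :
    Ĝ[G, x₀, y] (Complex.I • v) (Complex.I • w) = Ĝ[G, x₀, y] v w := by
  rw [ContinuousLinearMap.bilinearComp_apply, ContinuousLinearMap.bilinearComp_apply,
    chartDeriv_symm_I_smul x₀ hy, chartDeriv_symm_I_smul x₀ hy, hH]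

/-- Mixed Hermitian antisymmetry: `Ĝ y (iv) w = -Ĝ y v (iw)` for a symmetric Hermitian metric.
[folklore] -/
theorem chartMetric_I_left (G : M → E →L[ℝ] E →L[ℝ] ℝ)
    (hH : ∀ x v w, G x (Complex.I • v) (Complex.I • w) = G x v w) (x₀ : M) {y : E}
    (hy : y ∈ (extChartAt 𝓘(ℝ, E) x₀).target) (v w : E) :
    Ĝ[G, x₀, y] (Complex.I • v) w = -Ĝ[G, x₀, y] v (Complex.I • w) := by
  have h := chartMetric_hermitian G hH x₀ hy v (Complex.I • w)
  rw [smul_smul, Complex.I_mul_I, neg_one_smul, map_neg] at h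
  linarith

end ChartMetric

section Smooth

variable {E : Type*} [NormedAddCommGroup E] [NormedSpace ℂ E]
  {M : Type*} [TopologicalSpace M] [ChartedSpace E M]
  [IsManifold 𝓘(ℝ, E) ∞ M]
  [RiemannianBundle (fun x : M ↦ TangentSpace 𝓘(ℝ, E) x)]
  [IsContMDiffRiemannianBundle 𝓘(ℝ, E) ∞ E (fun x : M ↦ TangentSpace 𝓘(ℝ, E) x)]

/-- The derivative of the inverse chart (as above). -/
local notation "Sc[" x₀ ", " y "]" => tangentCoordChange 𝓘(ℝ, E) x₀
  ((extChartAt 𝓘(ℝ, E) x₀).symm y) ((extChartAt 𝓘(ℝ, E) x₀).symm y)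

/-- The coordinate expression of the metric (as above). -/
local notation "Ĝ[" G ", " x₀ ", " y "]" => ContinuousLinearMap.bilinearComp
  (G ((extChartAt 𝓘(ℝ, E) x₀).symm y)) (Sc[x₀, y]) (Sc[x₀, y])

omit [IsManifold 𝓘(ℝ, E) ∞ M]
  [IsContMDiffRiemannianBundle 𝓘(ℝ, E) ∞ E fun x : M ↦ TangentSpace 𝓘(ℝ, E) x] in
/-- `Ĝ c = G x₀` is positive definite (it is the inner product of `T_{x₀} M`). [folklore] -/
theorem chartMetric_pos (G : M → E →L[ℝ] E →L[ℝ] ℝ)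
    (hG : ∀ (x : M) (v w : TangentSpace 𝓘(ℝ, E) x), G x v w = ⟪v, w⟫) (x₀ : M) (a : E)
    (ha : a ≠ 0) : 0 < G x₀ a a := by
  rw [hG x₀]
  exact real_inner_self_pos.2 ha

set_option synthInstance.maxHeartbeats 200000 in
/-- **The coordinate expression of a smooth metric is `C^∞` on the chart target.** For `y` in the
target of the chart at `x₀`, `Ĝ` is `C^∞` at `y`: on the target, `Ĝ` is the second component of
the trivialization at `x₀` of the smooth metric section, composed with `e⁻¹`
(`trivializationAt_bilinForm_apply₂`, `TangentBundle.symmL_trivializationAt`). Voisin (2002),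
§3.1.2. [cite: Voisin2002, §3.1.2] -/
theorem contDiffAt_chartMetric (G : M → E →L[ℝ] E →L[ℝ] ℝ)
    (hG : ∀ (x : M) (v w : TangentSpace 𝓘(ℝ, E) x), G x v w = ⟪v, w⟫) (x₀ : M) {y : E}
    (hy : y ∈ (extChartAt 𝓘(ℝ, E) x₀).target) :
    ContDiffAt ℝ ∞ (fun y ↦ Ĝ[G, x₀, y]) y := by
  obtain ⟨gs, hgs, hinner⟩ := IsContMDiffRiemannianBundle.exists_contMDiff (IB := 𝓘(ℝ, E))
    (n := ∞) (F := E) (E := fun x : M ↦ TangentSpace 𝓘(ℝ, E) x)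
  set tr := trivializationAt (E →L[ℝ] E →L[ℝ] ℝ)
    (fun x : M ↦ TangentSpace 𝓘(ℝ, E) x →L[ℝ] TangentSpace 𝓘(ℝ, E) x →L[ℝ] ℝ) x₀ with htr
  -- the coordinate expression of the section in the trivialization at `x₀`
  set F : M → (E →L[ℝ] E →L[ℝ] ℝ) := fun x ↦ (tr ⟨x, gs x⟩).2 with hF
  -- it is smooth at every point of the chart domain
  have hFs : ∀ z ∈ (chartAt E x₀).source, ContMDiffAt 𝓘(ℝ, E) 𝓘(ℝ, E →L[ℝ] E →L[ℝ] ℝ) ∞ F z := by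
    intro z hz
    have hsrc : (⟨z, gs z⟩ : TotalSpace (E →L[ℝ] E →L[ℝ] ℝ)
        (fun x : M ↦ TangentSpace 𝓘(ℝ, E) x →L[ℝ] TangentSpace 𝓘(ℝ, E) x →L[ℝ] ℝ)) ∈ tr.source := by
      rw [htr, Trivialization.mem_source]
      simpa using hz
    exact ((tr.contMDiffAt_iff (f := fun x : M ↦ TotalSpace.mk' (E →L[ℝ] E →L[ℝ] ℝ) x (gs x))
      hsrc).1 (hgs z)).2
  -- on the target, `Ĝ = F ∘ e⁻¹`
  have hev : ∀ y ∈ (extChartAt 𝓘(ℝ, E) x₀).target,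
      Ĝ[G, x₀, y] = F ((extChartAt 𝓘(ℝ, E) x₀).symm y) := by
    intro y hy
    set z : M := (extChartAt 𝓘(ℝ, E) x₀).symm y with hz
    have hzs : z ∈ (chartAt E x₀).source := by
      rw [← extChartAt_source 𝓘(ℝ, E)]
      exact (extChartAt 𝓘(ℝ, E) x₀).map_target hy
    have hS : Sc[x₀, y] = (trivializationAt E (TangentSpace 𝓘(ℝ, E)) x₀).symmL ℝ z := by
      rw [TangentBundle.symmL_trivializationAt hzs, ← hz, (extChartAt 𝓘(ℝ, E) x₀).right_inv hy,
        mfderivWithin_extChartAt_symm_eq_tangentCoordChange hy]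
    ext v w
    rw [ContinuousLinearMap.bilinearComp_apply, hF, htr, trivializationAt_bilinForm_apply₂, ← hinner,
      hG, hS]
    rfl
  -- smoothness of `F ∘ e⁻¹` at `y`
  have h1 : ContMDiffWithinAt 𝓘(ℝ, E) 𝓘(ℝ, E →L[ℝ] E →L[ℝ] ℝ) ∞
      (F ∘ (extChartAt 𝓘(ℝ, E) x₀).symm) (range 𝓘(ℝ, E)) y := by
    have hzs : (extChartAt 𝓘(ℝ, E) x₀).symm y ∈ (chartAt E x₀).source := by
      rw [← extChartAt_source 𝓘(ℝ, E)]
      exact (extChartAt 𝓘(ℝ, E) x₀).map_target hy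
    exact (hFs _ hzs).comp_contMDiffWithinAt y (contMDiffWithinAt_extChartAt_symm_range x₀ hy)
  have h2 : ContDiffAt ℝ ∞ (F ∘ (extChartAt 𝓘(ℝ, E) x₀).symm) y := by
    have := contMDiffWithinAt_iff_contDiffWithinAt.1 h1
    rw [ModelWithCorners.Boundaryless.range_eq_univ, contDiffWithinAt_univ] at this
    exact this
  refine h2.congr_of_eventuallyEq ?_
  filter_upwards [(isOpen_extChartAt_target (I := 𝓘(ℝ, E)) x₀).mem_nhds hy] with y' hy'
  exact hev y' hy'

/-- Continuity form of `contDiffAt_chartMetric` at the centre. [folklore] -/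
theorem eventually_contDiffAt_chartMetric (G : M → E →L[ℝ] E →L[ℝ] ℝ)
    (hG : ∀ (x : M) (v w : TangentSpace 𝓘(ℝ, E) x), G x v w = ⟪v, w⟫) (x₀ : M) :
    ∀ᶠ y in 𝓝 (extChartAt 𝓘(ℝ, E) x₀ x₀), ContDiffAt ℝ ∞ (fun y ↦ Ĝ[G, x₀, y]) y := by
  filter_upwards [(isOpen_extChartAt_target (I := 𝓘(ℝ, E)) x₀).mem_nhds
    (mem_extChartAt_target x₀)] with y hy
  exact contDiffAt_chartMetric G hG x₀ hy

end Smooth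

section KaehlerJet

variable {E : Type*} [NormedAddCommGroup E] [NormedSpace ℂ E]
  {M : Type*} [TopologicalSpace M] [ChartedSpace E M]
  [IsManifold 𝓘(ℝ, E) ∞ M] [IsManifold 𝓘(ℂ, E) ω M]
  [RiemannianBundle (fun x : M ↦ TangentSpace 𝓘(ℝ, E) x)]

/-- The derivative of the inverse chart (as above). -/
local notation "Sc[" x₀ ", " y "]" => tangentCoordChange 𝓘(ℝ, E) x₀
  ((extChartAt 𝓘(ℝ, E) x₀).symm y) ((extChartAt 𝓘(ℝ, E) x₀).symm y)

/-- The coordinate expression of the metric (as above). -/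
local notation "Ĝ[" G ", " x₀ ", " y "]" => ContinuousLinearMap.bilinearComp
  (G ((extChartAt 𝓘(ℝ, E) x₀).symm y)) (Sc[x₀, y]) (Sc[x₀, y])

/-- **The chart representative of the Kähler form.** For a Hermitian metric
(`G x v w = ⟪v, w⟫ₓ`, `hH`) and `y` in the target of the chart at `x₀`, the representative of the
Kähler form `ω(v, w) = ⟪Jv, w⟫` is `(a, b) ↦ Ĝ y (ia) b`. [cite: Voisin2002, §3.1.2] -/
theorem inChart_kaehlerForm_apply (G : M → E →L[ℝ] E →L[ℝ] ℝ)
    (hG : ∀ (x : M) (v w : TangentSpace 𝓘(ℝ, E) x), G x v w = ⟪v, w⟫)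
    (hH : ∀ x v w, G x (Complex.I • v) (Complex.I • w) = G x v w) (x₀ : M) {y : E}
    (hy : y ∈ (extChartAt 𝓘(ℝ, E) x₀).target) (v : Fin 2 → E) :
    (RiemannianBundle.g (E := fun x : M ↦ TangentSpace 𝓘(ℝ, E) x)).kaehlerForm.inChart x₀ y v =
      Ĝ[G, x₀, y] (Complex.I • v 0) (v 1) := by
  have hherm : (RiemannianBundle.g (E := fun x : M ↦ TangentSpace 𝓘(ℝ, E) x)).IsHermitian := by
    intro x a b
    change inner ℝ (tangentJ E x a) (tangentJ E x b) = inner ℝ a b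
    rw [← hG, ← hG, tangentJ_apply, tangentJ_apply, hH]
  rw [MForm.inChart_eq_of_mem_target _ hy, ContinuousAlternatingMap.compContinuousLinearMap_apply]
  change (RiemannianBundle.g (E := fun x : M ↦ TangentSpace 𝓘(ℝ, E) x)).kaehlerForm
    ((extChartAt 𝓘(ℝ, E) x₀).symm y)
    (fun i ↦ Sc[x₀, y] (v i) : Fin 2 → TangentSpace 𝓘(ℝ, E) ((extChartAt 𝓘(ℝ, E) x₀).symm y)) = _
  have hv : (fun i ↦ Sc[x₀, y] (v i) : Fin 2 → TangentSpace 𝓘(ℝ, E) ((extChartAt 𝓘(ℝ, E) x₀).symm y)) =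
      (![Sc[x₀, y] (v 0), Sc[x₀, y] (v 1)] :
        Fin 2 → TangentSpace 𝓘(ℝ, E) ((extChartAt 𝓘(ℝ, E) x₀).symm y)) := by
    funext i
    fin_cases i <;> rfl
  rw [hv, Bundle.RiemannianMetric.kaehlerForm_apply_of_isHermitian _ hherm, tangentJ_apply]
  change @inner ℝ (TangentSpace 𝓘(ℝ, E) ((extChartAt 𝓘(ℝ, E) x₀).symm y)) _
    (HSMul.hSMul (β := E) (γ := E) Complex.I (Sc[x₀, y] (v 0))) (Sc[x₀, y] (v 1)) = _
  rw [← hG, ← chartDeriv_symm_I_smul x₀ hy, ContinuousLinearMap.bilinearComp_apply]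

set_option synthInstance.maxHeartbeats 200000 in
/-- **The Kähler relation for the first jet of the metric in a chart.** If the Kähler form of the
Hermitian metric is closed (`hK`), then at the centre `c` of the chart at `x₀` the derivative
`D = DĜ(c)` of the coordinate expression of the metric satisfies
`D u (iv) w - D v (iu) w + D w (iu) v = 0` for all `u v w` — the chart expression of
`dω(x₀)(u, v, w) = 0`. This is the hypothesis `hK` of `koszul_J'` (Voisin (2002), Prop. 3.14:
Kähler metrics are exactly the Hermitian metrics osculating the flat one to order two).
[cite: Voisin2002, §3.1.3 Thm. 3.13, Prop. 3.14] -/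
theorem chartMetric_kaehler_jet [CompleteSpace E] (G : M → E →L[ℝ] E →L[ℝ] ℝ)
    (hG : ∀ (x : M) (v w : TangentSpace 𝓘(ℝ, E) x), G x v w = ⟪v, w⟫)
    (hH : ∀ x v w, G x (Complex.I • v) (Complex.I • w) = G x v w)
    (hK : IsClosedForm (RiemannianBundle.g (E := fun x : M ↦ TangentSpace 𝓘(ℝ, E) x)).kaehlerForm)
    (x₀ : M) {D : E →L[ℝ] E →L[ℝ] E →L[ℝ] ℝ}
    (hD : HasFDerivAt (fun y ↦ Ĝ[G, x₀, y]) D (extChartAt 𝓘(ℝ, E) x₀ x₀)) (u v w : E) :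
    D u (Complex.I • v) w - D v (Complex.I • u) w + D w (Complex.I • u) v = 0 := by
  set c : E := extChartAt 𝓘(ℝ, E) x₀ x₀ with hc
  set kf := (RiemannianBundle.g (E := fun x : M ↦ TangentSpace 𝓘(ℝ, E) x)).kaehlerForm with hkf
  -- `dω(x₀) = 0` in the chart: `extDeriv (kf.inChart x₀) c = 0`
  have hd : extDeriv (kf.inChart x₀) c = 0 := by
    have h := hK
    rw [IsClosedForm] at h
    have hx := congrFun h x₀
    rw [Pi.zero_apply, mextDeriv_eq_extDerivWithin, ModelWithCorners.Boundaryless.range_eq_univ,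
      extDerivWithin_univ] at hx
    exact hx
  -- the bilinear-in-`(B, pair)` evaluation `Ψ B (a, b) = B (ia) b` and the representative
  -- `kf.inChart x₀ y = Ψ (Ĝ y)` near `c`
  have hrep : ∀ y ∈ (extChartAt 𝓘(ℝ, E) x₀).target, ∀ p : Fin 2 → E,
      kf.inChart x₀ y p = Ĝ[G, x₀, y] (Complex.I • p 0) (p 1) := fun y hy p ↦
    inChart_kaehlerForm_apply G hG hH x₀ hy p
  -- differentiability of the representative at `c` (from that of `Ĝ`)
  have hdiffĜ : DifferentiableAt ℝ (fun y ↦ Ĝ[G, x₀, y]) c := hD.differentiableAt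
  -- the map `y ↦ (p ↦ Ĝ y (i p 0) (p 1))` evaluated: derivative along `u` at `c`
  have key : ∀ (p : Fin 2 → E) (a : E),
      fderiv ℝ (fun y ↦ kf.inChart x₀ y p) c a = D a (Complex.I • p 0) (p 1) := by
    intro p a
    have hev : (fun y ↦ kf.inChart x₀ y p) =ᶠ[𝓝 c]
        fun y ↦ Ĝ[G, x₀, y] (Complex.I • p 0) (p 1) := by
      filter_upwards [(isOpen_extChartAt_target (I := 𝓘(ℝ, E)) x₀).mem_nhds
        (mem_extChartAt_target x₀)] with y hy
      exact hrep y hy p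
    rw [hev.fderiv_eq]
    -- derivative of `y ↦ Ĝ y a₀ b₀` is `a ↦ D a a₀ b₀`
    have h1 : HasFDerivAt (fun y ↦ Ĝ[G, x₀, y] (Complex.I • p 0))
        ((Ĝ[G, x₀, c]).comp (0 : E →L[ℝ] E) + D.flip (Complex.I • p 0)) c :=
      hD.clm_apply (hasFDerivAt_const _ c)
    have h2 : HasFDerivAt (fun y ↦ Ĝ[G, x₀, y] (Complex.I • p 0) (p 1))
        ((Ĝ[G, x₀, c] (Complex.I • p 0)).comp (0 : E →L[ℝ] E) +
          ((Ĝ[G, x₀, c]).comp (0 : E →L[ℝ] E) + D.flip (Complex.I • p 0)).flip (p 1)) c :=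
      h1.clm_apply (hasFDerivAt_const _ c)
    rw [h2.fderiv]
    simp only [ContinuousLinearMap.comp_zero, zero_add, ContinuousLinearMap.flip_apply]
  -- the representative is `Φ ∘ Ĝ` on the target, `Φ` the smooth (linear) model expression of
  -- the Kähler form; hence it is differentiable at `c`
  obtain ⟨Φ, hΦd, hΦa, -⟩ := exists_contDiff_kaehlerForm_eq (E := E) (M := M)
  have hGs : ∀ x a b, G x a b = G x b a := fun x a b ↦ by rw [hG, hG, real_inner_comm]
  have hrepΦ : ∀ y ∈ (extChartAt 𝓘(ℝ, E) x₀).target, kf.inChart x₀ y = Φ (Ĝ[G, x₀, y]) := by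
    intro y hy
    ext p
    rw [hrep y hy, hΦa, chartMetric_I_left G hH x₀ hy (p 1) (p 0),
      chartMetric_symm G hGs x₀ y (p 1)]
    ring
  have hdiff : DifferentiableAt ℝ (kf.inChart x₀) c := by
    have h1 : DifferentiableAt ℝ (fun y ↦ Φ (Ĝ[G, x₀, y])) c :=
      ((hΦd.differentiable (by simp)).differentiableAt).comp c hdiffĜ
    refine h1.congr_of_eventuallyEq ?_
    filter_upwards [(isOpen_extChartAt_target (I := 𝓘(ℝ, E)) x₀).mem_nhds
      (mem_extChartAt_target x₀)] with y hy
    exact hrepΦ y hy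
  -- evaluate `extDeriv (kf.inChart x₀) c (u, v, w) = 0`
  have h0 := congrArg (fun T : E [⋀^Fin (2 + 1)]→L[ℝ] ℝ ↦ T ![u, v, w]) hd
  simp only [ContinuousAlternatingMap.coe_zero, Pi.zero_apply] at h0
  rw [extDeriv_apply hdiff, Fin.sum_univ_three, key, key, key] at h0
  have r0 : Fin.removeNth 0 ![u, v, w] = ![v, w] := by
    funext i; fin_cases i <;> rfl
  have r1 : Fin.removeNth 1 ![u, v, w] = ![u, w] := by
    funext i; fin_cases i <;> rfl
  have r2 : Fin.removeNth 2 ![u, v, w] = ![u, v] := by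
    funext i; fin_cases i <;> rfl
  simp only [r0, r1, r2, Matrix.cons_val_zero, Matrix.cons_val_one, Matrix.head_cons,
    Fin.val_zero, Fin.val_one, Fin.val_two, pow_zero, pow_one, one_smul, neg_smul,
    Matrix.cons_val_two, Matrix.tail_cons] at h0
  -- h0 : D u (iv) w + -(D v (iu) w) + D w (iu) v = 0  (up to the form of the signs)
  linear_combination h0

end KaehlerJet

end Literature.Geometry.Kaehler
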